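import Summits.KontsevichZagierPeriods.KontsevichZagierPeriods.Theorems.RootDecompZetaThreeFrontierWordFacesThreeP3

/-!
# Route A‴ — item 32433 `GZNormalFormWThree`: the registered stub `gz_ladder.stub_three_wlog` BY NAME AND SIGNATURE (part 4/4)

The registered skeleton `gz_ladder` on item stmt-KontsevichZagierPeriods-32433 (writer decomp-kz-writer-1 g5, skeleton sha
095cff744e3fff52…, namespace `…Cruxes.GZNormalFormWThree.GZLadder`, stubs `stub_le_two` / `stub_three_wlog` / `stub_three_reduce` /
`stub_three_layer`) states `stub_three_wlog : ∀ r : KZ.IntegralRep 3, IsGZ 3 r → IsReducedThree r` over the skeleton-local defs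
`simplex`, `IsGZ`, `IsReducedThree`, reproduced VERBATIM here (lens-1 g11 §21f/§22g).  It is `isReduced_of_isGZ_three` of part 3
unfolded (`simplex 3` is literally `KZ.openOrderedSimplex 3`).  NOTE for the later landing of `stub_le_two` (lens-1 g10 §21f): import
THIS module for `simplex` / `IsGZ` instead of re-declaring them.
-/

noncomputable section

set_option linter.dupNamespace false

namespace Summit.KontsevichZagierPeriods.KontsevichZagierPeriods.Cruxes.GZNormalFormWThree.GZLadder

open Set MeasureTheory Literature.NumberTheory.Transcendental

/-- `Δ_k` in the route file's spelling (verbatim, skeleton `gz_ladder`) -/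
def simplex (k : ℕ) : Set (Fin k → ℝ) := {t | (∀ i, 0 < t i) ∧ (∀ i, t i < 1) ∧ StrictAnti t}

/-- genus-zero data of dimension `k` (verbatim, skeleton `gz_ladder`) -/
def IsGZ (k : ℕ) (r : KZ.IntegralRep k) : Prop :=
  r.domain = simplex k ∧ ∃ (p : MvPolynomial (Fin k) ℚ) (a : Fin k → Fin k → ℕ) (b c : Fin k → ℕ),
    EqOn r.integrand (fun t => MvPolynomial.aeval t p /
      ((∏ i, t i ^ b i) * (∏ i, (1 - t i) ^ c i) * ∏ i, ∏ j, if i < j then (t i - t j) ^ a i j else 1)) r.domain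

/-- REDUCED dimension-3 data: poles only at the two vertices and the three edges where integrability does NOT force cancellation —
`P/(t₀^{β₀} t₁^{β₁} (1-t₁)^{γ₁} (1-t₂)^{γ₂} (t₀-t₂)^{α})` (verbatim, skeleton `gz_ladder`). -/
def IsReducedThree (r : KZ.IntegralRep 3) : Prop :=
  r.domain = simplex 3 ∧ ∃ (p : MvPolynomial (Fin 3) ℚ) (β₀ β₁ γ₁ γ₂ α : ℕ),
    EqOn r.integrand (fun t => MvPolynomial.aeval t p /
      (t 0 ^ β₀ * t 1 ^ β₁ * (1 - t 1) ^ γ₁ * (1 - t 2) ^ γ₂ * (t 0 - t 2) ^ α)) r.domain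

/-- the skeleton's `simplex k` IS `KZ.openOrderedSimplex k` -/
theorem simplex_eq_openOrderedSimplex (k : ℕ) : simplex k = KZ.openOrderedSimplex k := rfl

/-- **`gz_ladder.stub_three_wlog` (the analytic WLOG of rung 3), PROVED** — by
`RootDecompZetaThreeFrontierWordMoves.isReduced_of_isGZ_three`: integrability on `Δ₃` forces the four face factors
`t₂^{b₂}`, `(t₁-t₂)^{a₁₂}`, `(t₀-t₁)^{a₀₁}`, `(1-t₀)^{c₀}` to cancel into the numerator. -/
theorem stub_three_wlog : ∀ r : KZ.IntegralRep 3, IsGZ 3 r → IsReducedThree r := by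
  rintro r ⟨hd, p, a, b, c, hi⟩
  exact ⟨hd, Summit.KontsevichZagierPeriods.KontsevichZagierPeriods.Theorems.RootDecompZetaThreeFrontierWordMoves.isReduced_of_isGZ_three
    r hd p a b c hi⟩

end Summit.KontsevichZagierPeriods.KontsevichZagierPeriods.Cruxes.GZNormalFormWThree.GZLadder
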